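import Literature.Geometry.Kaehler.ComplexTorusWeylOperatorPolarizationIsometry
import Literature.Geometry.Kaehler.ComplexTorusWeylPolarizationSL2Transpose
import HarnessLib

/-!
# André's Hodge involution `*_H` on the cohomology of a complex torus: `*_H = (−1)^{g + n(n−1)/2} w` on `Hⁿ(X; ℂ)`, and
# VOISIN'S WEYL POLARIZATION FORM IS ANDRÉ'S `(x, y) ↦ ∫ x ∪ *_H y`: `Q_w(x, y) = (−1)^g ∫_X x ∧ *_H(y)`
# (André 1996 §1.1–§1.2: "`*_H x = Σ (−1)^{(j−2k)(j−2k+1)/2} (k!/(d−j+k)!) L^{d−j+k} x_{j−2k}`", "l'élément `(0 1 ; −1 0)` de `SL₂` s'envoie sur `± *_H`")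

Layer `Literature/Geometry/Kaehler`, namespace `Literature.Geometry.Kaehler.ComplexTorus`; lane `lit-hodgefound` (Track 2 foundations library, Layer A4), prover
seat `lit-hodgefound-p35` (generation 49, row g49-#3). THEOREMS ONLY (no definition, no named fact, no instance, no notation; D-0026 net debt `0`). It READS
p34's abstract `HasLefschetzProperty.andreHodgeInvolution` (`Literature/Algebra/Lie/LefschetzModuleWeylOperator`: André's `*_H` WITH ITS FACTOR `k!/(d−j+k)!`, an involution
with `*_H L *_H = ᶜΛ`, and `*_H = (−1)^{d + n(n−1)/2} w` on `Hⁿ` when all strings have co-length `≤ d`) on the torus-forms carrier `H•(X; ℂ) = GForm E ℂ` with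
`d = g = dim_ℂ X` (`depth_countingG`), and identifies the rows g48-#2/#3 of this seat (`weylPairing`, `weylPolarizationForm`, `IsRiemannForm.weylPolarization`:
Voisin's `Q_w = (−1)^{k(k−1)/2} ∫_X w(x) ∧ y`) with André's printed bilinear form `(x, y) ↦ ∫ x ∪ *_H y`.

THE POINT. On `Hⁿ(X; ℂ)` André's involution is `*_H = (−1)^{g + n(n−1)/2} · w` (`w` the Weyl element of the Lefschetz `SL₂`), so Voisin's sign `(−1)^{n(n−1)/2}` in
`Q_w` is exactly the passage from `w` to `*_H`, up to the GLOBAL sign `(−1)^g`: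
**`Q_w(x, y) = (−1)^g ∫_X x ∧ *_H(y) = (−1)^g ∫_X *_H(x) ∧ y`** on every `Hⁿ(X, ℚ)`, `n ≤ 2g`. The residual `(−1)^g` is the tree's orientation convention
(`∫_X η^{∧g} = (−1)^g g! d₁⋯d_g`, Lange's `c₁(L) = −Im H`: `w(1) = d₁⋯d_g·[pt]` integrates positively while `*_H(1) = η^{∧g}/g!` does with the sign `(−1)^g`).
Consequently André's Remarque "cet opérateur star et `*_H` ont les mêmes propriétés de positivité sur les cycles réels de type `(p,p)`" reads, in the tree's
conventions, `(−1)^g ∫_X x ∧ *_H(x) > 0` for every non-zero real class `x` of type `(p, p)` (from the Hodge–Riemann relations of row g48-#2), in EVERY degree `2p ≤ 2g`.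

## What is proved (`X = E/Λ`, `g = dim_ℂ E`, `η` a non-degenerate real `2`-form, `w = (hasLefschetzProperty_lefschetzG hη).weylOperator isZGrading_countingG`,
`*_H = (hasLefschetzProperty_lefschetzG hη).andreHodgeInvolution isZGrading_countingG g`, `B_k = weylPairing Φ hη e _`, `Q_w = weylPolarizationForm`)

* §1 **`andreHodgeInvolution_of`: `*_H(of n x) = (−1)^{g + n(n−1)/2} · w(of n x)`** ("s'envoie sur `± *_H`, le signe étant `(−1)^{…}` sur la composante `Hʲ`", the sign
  made explicit), `andreHodgeInvolution_of_apply`, `andreHodgeInvolution_of_eq_of` (`*_H : Hⁿ → H^{2g−n}`), `andreHodgeInvolution_mul_lefschetzG_mul_andreHodgeInvolution`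
  (`*_H L_η *_H = Λ_η` on the nose), `andreHodgeInvolution_apply_mem_rationalFormsG` / `andreHodgeInvolution_of_apply_mem_rationalForms` (`*_H` is defined over `ℚ` for
  `η ∈ NS(X) ⊗ ℚ`), `andreHodgeInvolution_of_apply_mem_typeSubmodule` (`*_H(H^{p,q}) ⊆ H^{g−q,g−p}`).
* §2 **`neg_one_pow_mul_weylPairing_eq_torusIntegral_andreHodgeInvolution_wedge`: `(−1)^{k(k−1)/2} B_k(x, y) = (−1)^g ∫_X *_H(x) ∧ y`**,
  **`…_eq_torusIntegral_wedge_andreHodgeInvolution`: `= (−1)^g ∫_X x ∧ *_H(y)`** (André's slot), `torusIntegral_andreHodgeInvolution_of_wedge_comm` ("`*_H` […] auto-adjoint"),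
  **`coe_weylPolarizationForm_eq_torusIntegral_wedge_andreHodgeInvolution`: `Q_w(γ, δ) = (−1)^g ∫_X γ ∧ *_H(δ)` on `Hᵏ(X, ℚ)`**, and for a Riemann form
  `IsRiemannForm.coe_weylPolarization_form_eq_torusIntegral_wedge_andreHodgeInvolution` (the `Polarization` of row g48-#3 is André's form up to `(−1)^g`).
* §3 `neg_one_pow_mul_weylPairing_andreHodgeInvolution_andreHodgeInvolution` (**`*_H` is a `Q_w`-ISOMETRY**: `ε_t B_t(*_H x, *_H y) = ε_k B_k(x, y)`),
  `neg_one_pow_mul_weylPairing_andreHodgeInvolution_left` (**`*_H` is `Q_w`-SELF-ADJOINT**: `ε_t B_t(*_H x, z) = ε_k B_k(x, *_H z)`).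
* §4 **`exists_pos_neg_one_pow_mul_torusIntegral_wedge_andreHodgeInvolution`: `(−1)^g ∫_X x ∧ *_H(x) = c > 0`** for `x ≠ 0` real of type `(p, p)`, every `2p ≤ 2g`, `η` positive
  of type `(1,1)` — André's positivity Remarque in the tree's orientation.
* §5 (appended, row g49-#5; junction with row g49-#2 `ComplexTorusWeylPolarizationSL2Transpose`) ANDRÉ'S PROP. 1.2, LAST CLAUSE, FOR HIS OWN FORM ON THE TORUS:
  **`torusIntegral_sl2Rep_of_apply_wedge_andreHodgeInvolution`: `∫_X (ρ(γ)x)_l ∧ *_H(y) = ∫_X x ∧ *_H((ρ(γᵀ)y)_k)` for every `γ ∈ SL₂(ℂ)`** (the global sign `(−1)^g`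
  cancels), `torusIntegral_andreHodgeInvolution_sl2Rep_of_apply_wedge` (`*` in the first slot), the unipotents `torusIntegral_exp_smul_lefschetzG_of_apply_wedge_andreHodgeInvolution`
  (`∫ (e^{aL}x)_l ∧ *_H y = ∫ x ∧ *_H (e^{aΛ}y)_k`), and **`torusIntegral_apply_of_wedge_andreHodgeInvolution_of_mem_adjoin_pair_of_commute`** (every `T ∈ ℂ[L_η, Λ_η]` commuting
  with `H` is symmetric for `∫ x ∧ *_H y`: "contiennent les projecteurs de Künneth").

## Sources, VERBATIM

* Y. André, *Pour une théorie inconditionnelle des motifs*, Publ. Math. IHÉS **83** (1996) [Andre1996Motifs] (held `paper:doi-10-1007-bf02698643`), §1.1 (p. 10 = p0007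
  L36–L60): "On définit aussi les involutions de Lefschetz et de Hodge respectivement par les formules : `*_L x = Σ L^{d−j+k} x_{j−2k}`,
  `*_H x = Σ (−1)^{(j−2k)(j−2k+1)/2} (k!/(d−j+k)!) L^{d−j+k} x_{j−2k}`"; §1.1 Remarque (p. 11 = p0008 L11–L14): "l'intérêt de l'introduction de `*_H` est que cet
  opérateur star et `*_H` ont les mêmes propriétés de positivité sur les cycles réels de type `(p,p)` […] Remarquons aussi que `L`, `*_L`, `*_H` et `ᶜΛ` sont
  auto-adjoints relativement à l'accouplement de dualité de Poincaré `(x, y) ↦ ∫ x ∪ y`."; §1.2 (p0008 L54–L55): "un calcul sans difficulté montre que l'élément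
  `(0 1 ; −1 0)` de `SL₂` s'envoie sur `± *_H`, le signe étant `(−1)^{…}` sur la composante `Hʲ`" (exponent unreadable in the scan; the abstract row proves
  `(−1)^{d + j(j−1)/2}`); Prop. 1.2 (p0008 L62–L66): "la transposition relative à la forme bilinéaire `(x, y) ↦ ∫ x ∪ *y` correspond à la transposition des
  matrices, pour `* = *_L` ou `*_H`."
* C. Voisin, *Hodge Theory and Complex Algebraic Geometry I* (CUP 2002) [VoisinHodgeI2002], §7.1.2 (ii) and Def. 7.7 (PDF p. 134: the sign `(−1)^{k(k−1)/2}`).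
* H. Lange, *Abelian Varieties over the Complex Numbers* (2023) [Lange2023AbelianVarietiesComplex], §1.7.2 Lemma 1.7.4 (`c₁(L) = −E`), Lemma 1.7.5
  (`∧^g E = (−1)^g g! d₁⋯d_g dx₁ ∧ dy₁ ∧ ⋯`); §6.2.4 Prop. 6.2.20 (p. 310).
* D. Huybrechts, *Complex Geometry* (2005) [Huybrechts2005], §1.2 Lemma 1.2.24 (ii), Prop. 1.2.31 (Weil's formula for `⋆Lʲα`).
* E. Looijenga, V. A. Lunts, Invent. Math. **129** (1997) [LooijengaLunts1997], §1 (1.7) p. 6 (`𝔤(𝔞, M)` defined over `ℚ`).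

## Scope

Invariant-forms carrier; `*_H` is p34's abstract operator specialised at `d = g` — no new definition; the sign `(−1)^g` is stated, not normalised away.
-/

noncomputable section

-- `Module ℂ` / `SMulZeroClass ℂ` synthesis on `E [⋀^Fin k]→L[ℝ] ℂ` (as in `ComplexTorusLefschetzDecomposition`)
set_option maxSynthPendingDepth 3

namespace Literature.Geometry.Kaehler

namespace ComplexTorus

open Module Function Finset Complex
open Literature.LinearAlgebra.Alternating Literature.Algebra.Lie Literature.Analysis.Complex

universe uE

variable {ι : Type*} [Fintype ι] [DecidableEq ι] {E : Type uE} [NormedAddCommGroup E] [NormedSpace ℂ E] [FiniteDimensional ℂ E] [Nontrivial E]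
  (Φ : (ι → ℝ) ≃L[ℝ] E) {η : E [⋀^Fin 2]→L[ℝ] ℝ} (hη : ∀ v : E, v ≠ 0 → ∃ w : E, η ![v, w] ≠ 0)

/-! ## §1 `*_H = (−1)^{g + n(n−1)/2} w` on `Hⁿ(X; ℂ)`; homogeneity; `*_H L *_H = Λ`; rationality; Hodge types -/

section Involution

include hη in
omit [Fintype ι] [DecidableEq ι] in
/-- **`*_H(of n x) = (−1)^{g + n(n−1)/2} · w(of n x)` on `Hⁿ(X; ℂ)`** (`g = dim_ℂ X`): André's "l'élément `(0 1 ; −1 0)` de `SL₂` s'envoie sur `± *_H`, le signe étant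
`(−1)^{…}` sur la composante `Hʲ`", with the sign `(−1)^{g + j(j−1)/2}` of the abstract row `andreHodgeInvolution_apply_of_mem_degreeSpace` (all strings of `H•(X)` have
co-length `≤ g = depth`). [cite: Andre1996Motifs, §1.1 (p. 10, definition of *_H) and §1.2 (p. 11)] -/
theorem andreHodgeInvolution_of {g : ℕ} (hg : finrank ℂ E = g) (n : ℕ) (x : E [⋀^Fin n]→L[ℝ] ℂ) :
    (hasLefschetzProperty_lefschetzG hη).andreHodgeInvolution isZGrading_countingG g (GForm.of n x) =
      ((-1 : ℂ) ^ (g + n * (n - 1) / 2)) • (hasLefschetzProperty_lefschetzG hη).weylOperator isZGrading_countingG (GForm.of n x) := by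
  have hd : depth (countingG E) ≤ g := by rw [depth_countingG, hg]
  rw [(hasLefschetzProperty_lefschetzG hη).andreHodgeInvolution_apply_of_mem_degreeSpace isZGrading_countingG hd (m := (n : ℤ) - (finrank ℂ E : ℤ))
      (n := n) (by rw [hg]; ring) (of_mem_degreeSpace_countingG n x), Nat.choose_two_right]

include hη in
omit [Fintype ι] [DecidableEq ι] in
/-- Componentwise: `(*_H(of n x))_t = (−1)^{g + n(n−1)/2} · w(of n x)_t`. [cite: Andre1996Motifs, §1.2 (p. 11)] -/
theorem andreHodgeInvolution_of_apply {g : ℕ} (hg : finrank ℂ E = g) (n t : ℕ) (x : E [⋀^Fin n]→L[ℝ] ℂ) :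
    (hasLefschetzProperty_lefschetzG hη).andreHodgeInvolution isZGrading_countingG g (GForm.of n x) t =
      ((-1 : ℂ) ^ (g + n * (n - 1) / 2)) • (hasLefschetzProperty_lefschetzG hη).weylOperator isZGrading_countingG (GForm.of n x) t := by
  rw [andreHodgeInvolution_of hη hg, Pi.smul_apply]

include hη in
omit [Fintype ι] [DecidableEq ι] in
/-- **`*_H : Hⁿ(X; ℂ) → H^{2g−n}(X; ℂ)`**: `*_H(of n x)` is homogeneous of degree `m`, `n + m = 2g` (as `w` is: `weylOperator_of_eq_of`).
[cite: Andre1996Motifs, §1.1 (p. 10: "L^{d−j+k} x_{j−2k}")] -/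
theorem andreHodgeInvolution_of_eq_of {g : ℕ} (hg : finrank ℂ E = g) {n m : ℕ} (h : n + m = 2 * g) (x : E [⋀^Fin n]→L[ℝ] ℂ) :
    (hasLefschetzProperty_lefschetzG hη).andreHodgeInvolution isZGrading_countingG g (GForm.of n x) =
      GForm.of m ((hasLefschetzProperty_lefschetzG hη).andreHodgeInvolution isZGrading_countingG g (GForm.of n x) m) := by
  rw [andreHodgeInvolution_of hη hg, Pi.smul_apply, GForm.of_smul, ← weylOperator_of_eq_of hη (show n + m = 2 * finrank ℂ E by omega)]

include hη in
omit [Fintype ι] [DecidableEq ι] in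
/-- Off the complementary degree the components vanish: `(*_H(of n x))_t = 0` for `n + t ≠ 2g`. [cite: Andre1996Motifs, §1.1 (p. 10)] -/
theorem andreHodgeInvolution_of_apply_of_ne {g : ℕ} (hg : finrank ℂ E = g) {n t : ℕ} (hn : n ≤ 2 * g) (h : n + t ≠ 2 * g) (x : E [⋀^Fin n]→L[ℝ] ℂ) :
    (hasLefschetzProperty_lefschetzG hη).andreHodgeInvolution isZGrading_countingG g (GForm.of n x) t = 0 := by
  rw [andreHodgeInvolution_of_eq_of hη hg (show n + (2 * g - n) = 2 * g by omega) x, GForm.of_apply_of_ne (by omega)]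

include hη in
omit [Fintype ι] [DecidableEq ι] in
/-- **`*_H L_η *_H = Λ_η` ON THE NOSE** (André's involution with its factor `k!/(d−j+k)!`; Kleiman's `⋆` only gives proportionality): the abstract
`andreHodgeInvolution_mul_e_mul_andreHodgeInvolution` with the torus dictionary `f = Λ_η` (`dual_lefschetzG_eq_lefschetzDualG`).
[cite: Andre1996Motifs, §1.1 (p. 11, "ᶜL = *_L L *_L, proportionnel à ᶜΛ") and Prop. 1.2 (p. 12, proof)] -/
theorem andreHodgeInvolution_mul_lefschetzG_mul_andreHodgeInvolution (d : ℕ) :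
    (hasLefschetzProperty_lefschetzG hη).andreHodgeInvolution isZGrading_countingG d * lefschetzG η *
        (hasLefschetzProperty_lefschetzG hη).andreHodgeInvolution isZGrading_countingG d = lefschetzDualG η := by
  rw [(hasLefschetzProperty_lefschetzG hη).andreHodgeInvolution_mul_e_mul_andreHodgeInvolution isZGrading_countingG d, dual_lefschetzG_eq_lefschetzDualG hη]

omit [Fintype ι] [DecidableEq ι] [NormedAddCommGroup E] [NormedSpace ℂ E] [FiniteDimensional ℂ E] [Nontrivial E] in
/-- `(−1)^N` as a rational scalar. [folklore] -/
private theorem neg_one_pow_smul_eq_ratCast_smul₉₂ {W : Type*} [AddCommGroup W] [Module ℂ W] (N : ℕ) (v : W) :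
    ((-1 : ℂ) ^ N) • v = (((-1 : ℚ) ^ N : ℚ) : ℂ) • v := by
  simp only [Rat.cast_pow, Rat.cast_neg, Rat.cast_one]

/-- **`*_H` is defined over `ℚ`**: `*_H(H•(X; ℚ)) ⊆ H•(X; ℚ)` for `η ∈ NS(X) ⊗ ℚ` non-degenerate (`w` is, `weylOperator_apply_mem_rationalFormsG`; the signs are rational).
[cite: LooijengaLunts1997, §1 (1.7) p. 6] [cite: Andre1996Motifs, §1.1 (p. 10)] -/
theorem andreHodgeInvolution_apply_mem_rationalFormsG (hQ : η ∈ neronSeveriQ Φ) (hη : ∀ v : E, v ≠ 0 → ∃ w : E, η ![v, w] ≠ 0) {g : ℕ} (hg : finrank ℂ E = g)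
    {w : GForm E ℂ} (hw : w ∈ rationalFormsG Φ) : (hasLefschetzProperty_lefschetzG hη).andreHodgeInvolution isZGrading_countingG g w ∈ rationalFormsG Φ := by
  rw [← sum_range_of_eq w, map_sum]
  refine Submodule.sum_mem _ fun n _ ↦ ?_
  rw [andreHodgeInvolution_of hη hg, neg_one_pow_smul_eq_ratCast_smul₉₂, Rat.cast_smul_eq_qsmul]
  exact Submodule.smul_mem _ _ (weylOperator_apply_mem_rationalFormsG Φ hQ hη (of_mem_rationalFormsG Φ ((mem_rationalFormsG_iff Φ).1 hw n)))

/-- Componentwise: `(*_H(of n x))_m ∈ Hᵐ(X; ℚ)` for `x ∈ Hⁿ(X; ℚ)`. [cite: LooijengaLunts1997, §1 (1.7) p. 6] [cite: Andre1996Motifs, §1.1 (p. 10)] -/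
theorem andreHodgeInvolution_of_apply_mem_rationalForms (hQ : η ∈ neronSeveriQ Φ) (hη : ∀ v : E, v ≠ 0 → ∃ w : E, η ![v, w] ≠ 0) {g : ℕ} (hg : finrank ℂ E = g)
    {n : ℕ} {x : E [⋀^Fin n]→L[ℝ] ℂ} (hx : x ∈ rationalForms Φ n) (m : ℕ) :
    (hasLefschetzProperty_lefschetzG hη).andreHodgeInvolution isZGrading_countingG g (GForm.of n x) m ∈ rationalForms Φ m :=
  (mem_rationalFormsG_iff Φ).1 (andreHodgeInvolution_apply_mem_rationalFormsG Φ hQ hη hg (of_mem_rationalFormsG Φ hx)) m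

include hη in
omit [Fintype ι] [DecidableEq ι] in
/-- **`*_H(H^{p,q} ∩ Hˢ) ⊆ H^{g−q,g−p} ∩ Hᵗ`** for `η` of type `(1,1)` (`s + t = 2g`, `p + q = s`; as `w`: Huybrechts' Lemma 1.2.24 (ii) for `± *_H`).
[cite: Huybrechts2005, §1.2 Lemma 1.2.24 (ii)] [cite: Andre1996Motifs, §1.1 (p. 10)] -/
theorem andreHodgeInvolution_of_apply_mem_typeSubmodule (h11 : ∀ u v : E, η ![Complex.I • u, Complex.I • v] = η ![u, v]) {g : ℕ} (hg : finrank ℂ E = g)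
    {s t p q p' q' : ℕ} (hst : s + t = 2 * g) (hpq : p + q = s) (hp' : p' + q = g) (hq' : q' + p = g) {x : E [⋀^Fin s]→L[ℝ] ℂ}
    (hx : x ∈ typeSubmodule E s p q) :
    (hasLefschetzProperty_lefschetzG hη).andreHodgeInvolution isZGrading_countingG g (GForm.of s x) t ∈ typeSubmodule E t p' q' := by
  rw [andreHodgeInvolution_of_apply hη hg]
  exact Submodule.smul_mem _ _ (weylOperator_of_apply_mem_typeSubmodule hη h11 (by omega) hpq (by omega) (by omega) hx)

end Involution

/-! ## §2 Voisin's `Q_w` is André's `(x, y) ↦ ∫ x ∪ *_H y`, up to `(−1)^g` -/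

section AndreForm

omit [Fintype ι] [DecidableEq ι] [NormedAddCommGroup E] [NormedSpace ℂ E] [FiniteDimensional ℂ E] [Nontrivial E] in
/-- `(−1)^g · (−1)^{g + a} = (−1)^a`. [folklore] -/
private theorem neg_one_pow_mul_neg_one_pow_add₉₂ (g a : ℕ) : (-1 : ℂ) ^ g * (-1) ^ (g + a) = (-1) ^ a := by
  rw [pow_add, ← mul_assoc, ← pow_add, ← two_mul, pow_mul, neg_one_sq, one_pow, one_mul]

/-- **`(−1)^{k(k−1)/2} B_k(x, y) = (−1)^g ∫_X *_H(x) ∧ y`** for `x, y ∈ Hᵏ(X; ℂ)`, `t + k = 2g` (`B_k(x, y) = ∫_X w(x)_t ∧ y` the Weyl pairing of row g48-#2/#3): Voisin's sign IS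
the passage `w ↦ *_H`, up to `(−1)^g`. [cite: Andre1996Motifs, §1.2 Prop. 1.2 (p. 11, "(x, y) ↦ ∫ x ∪ *y […] pour * = *_H")] [cite: VoisinHodgeI2002, §7.1.2 Def. 7.7 (PDF p. 134)] -/
theorem neg_one_pow_mul_weylPairing_eq_torusIntegral_andreHodgeInvolution_wedge {g : ℕ} (e : Fin (2 * g) ≃ ι) {k t : ℕ} (htk : t + k = 2 * g)
    (x y : E [⋀^Fin k]→L[ℝ] ℂ) :
    (-1 : ℂ) ^ (k * (k - 1) / 2) * weylPairing Φ hη e htk x y =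
      (-1 : ℂ) ^ g * torusIntegral Φ e ((((hasLefschetzProperty_lefschetzG hη).andreHodgeInvolution isZGrading_countingG g (GForm.of k x) t).wedge y).domDomCongr
        (finCongr htk)) := by
  have hg : finrank ℂ E = g := finrank_eq_of_finTwoMulEquiv Φ e
  rw [weylPairing_apply, andreHodgeInvolution_of_apply hη hg, wedge_smul_left_complex, domDomCongr_finCongr_smul, torusIntegral_smul, ← mul_assoc,
    neg_one_pow_mul_neg_one_pow_add₉₂]

/-- **`(−1)^{k(k−1)/2} B_k(x, y) = (−1)^g ∫_X x ∧ *_H(y)`** — ANDRÉ'S FORM `(x, y) ↦ ∫ x ∪ *_H y` with `*` in André's slot (`*_H`, like `w`, is self-adjoint for the cup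
product: `torusIntegral_weylOperator_of_wedge_comm`). [cite: Andre1996Motifs, §1.1 Remarque (p. 11, "*_H […] auto-adjoint") and §1.2 Prop. 1.2 (p. 11)]
[cite: VoisinHodgeI2002, §7.1.2 Def. 7.7 (PDF p. 134)] -/
theorem neg_one_pow_mul_weylPairing_eq_torusIntegral_wedge_andreHodgeInvolution {g : ℕ} (e : Fin (2 * g) ≃ ι) {k t : ℕ} (htk : t + k = 2 * g)
    (hkt : k + t = 2 * g) (x y : E [⋀^Fin k]→L[ℝ] ℂ) :
    (-1 : ℂ) ^ (k * (k - 1) / 2) * weylPairing Φ hη e htk x y =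
      (-1 : ℂ) ^ g * torusIntegral Φ e ((x.wedge ((hasLefschetzProperty_lefschetzG hη).andreHodgeInvolution isZGrading_countingG g (GForm.of k y) t)).domDomCongr
        (finCongr hkt)) := by
  have hg : finrank ℂ E = g := finrank_eq_of_finTwoMulEquiv Φ e
  rw [weylPairing_apply, torusIntegral_weylOperator_of_wedge_comm Φ hη e htk hkt, andreHodgeInvolution_of_apply hη hg, wedge_smul_right_complex,
    domDomCongr_finCongr_smul, torusIntegral_smul, ← mul_assoc, neg_one_pow_mul_neg_one_pow_add₉₂]

/-- **"`*_H` […] auto-adjoint relativement à l'accouplement de dualité de Poincaré": `∫_X *_H(x) ∧ y = ∫_X x ∧ *_H(y)`** for `x, y ∈ Hᵏ(X; ℂ)`, every non-degenerate `η`.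
[cite: Andre1996Motifs, §1.1 Remarque (p. 11)] -/
theorem torusIntegral_andreHodgeInvolution_of_wedge_comm {g : ℕ} (e : Fin (2 * g) ≃ ι) {k t : ℕ} (htk : t + k = 2 * g) (hkt : k + t = 2 * g)
    (x y : E [⋀^Fin k]→L[ℝ] ℂ) :
    torusIntegral Φ e ((((hasLefschetzProperty_lefschetzG hη).andreHodgeInvolution isZGrading_countingG g (GForm.of k x) t).wedge y).domDomCongr (finCongr htk)) =
      torusIntegral Φ e ((x.wedge ((hasLefschetzProperty_lefschetzG hη).andreHodgeInvolution isZGrading_countingG g (GForm.of k y) t)).domDomCongr (finCongr hkt)) := by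
  have h1 := neg_one_pow_mul_weylPairing_eq_torusIntegral_andreHodgeInvolution_wedge Φ hη e htk x y
  rw [neg_one_pow_mul_weylPairing_eq_torusIntegral_wedge_andreHodgeInvolution Φ hη e htk hkt x y] at h1
  exact (mul_left_cancel₀ (pow_ne_zero _ (neg_ne_zero.2 one_ne_zero)) h1).symm

/-- **VOISIN'S WEYL POLARIZATION FORM IS ANDRÉ'S `(x, y) ↦ ∫ x ∪ *_H y`, UP TO `(−1)^g`: `Q_w(γ, δ) = (−1)^g ∫_X γ ∧ *_H(δ)`** for `γ, δ ∈ Hᵏ(X; ℚ)` (`k ≤ 2g`,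
`η ∈ NS(X) ⊗ ℚ` non-degenerate; `Q_w = weylPolarizationForm = (−1)^{k(k−1)/2} B_k`). [cite: Andre1996Motifs, §1.1 Remarque and §1.2 Prop. 1.2 (p. 11)]
[cite: VoisinHodgeI2002, §7.1.2 Def. 7.7 (PDF p. 134)] -/
theorem coe_weylPolarizationForm_eq_torusIntegral_wedge_andreHodgeInvolution (hQ : η ∈ neronSeveriQ Φ) (hη : ∀ v : E, v ≠ 0 → ∃ w : E, η ![v, w] ≠ 0) {g : ℕ}
    (e : Fin (2 * g) ≃ ι) {k t : ℕ} (htk : t + k = 2 * g) (hkt : k + t = 2 * g) (γ δ : rationalForms Φ k) :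
    ((weylPolarizationForm Φ hQ hη e htk γ δ : ℚ) : ℂ) =
      (-1 : ℂ) ^ g * torusIntegral Φ e (((γ : E [⋀^Fin k]→L[ℝ] ℂ).wedge
        ((hasLefschetzProperty_lefschetzG hη).andreHodgeInvolution isZGrading_countingG g (GForm.of k (δ : E [⋀^Fin k]→L[ℝ] ℂ)) t)).domDomCongr (finCongr hkt)) := by
  rw [coe_weylPolarizationForm, neg_one_pow_mul_weylPairing_eq_torusIntegral_wedge_andreHodgeInvolution Φ hη e htk hkt]

/-- **For a polarized complex torus the `Polarization` of row g48-#3 (`IsRiemannForm.weylPolarization`, every degree `s ≤ 2g`) is André's form: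
`Q_w(γ, δ) = (−1)^g ∫_X γ ∧ *_H(δ)`.** [cite: Andre1996Motifs, §1.1 Remarque and §1.2 Prop. 1.2 (p. 11)] [cite: VoisinHodgeI2002, §7.1.2 Def. 7.7 (PDF p. 134)] -/
theorem IsRiemannForm.coe_weylPolarization_form_eq_torusIntegral_wedge_andreHodgeInvolution (hR : IsRiemannForm Φ η) {g : ℕ} (e : Fin (2 * g) ≃ ι) {s t : ℕ}
    (hts : t + s = 2 * g) (hst : s + t = 2 * g) (γ δ : rationalForms Φ s) :
    (((hR.weylPolarization Φ e hts).form γ δ : ℚ) : ℂ) =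
      (-1 : ℂ) ^ g * torusIntegral Φ e (((γ : E [⋀^Fin s]→L[ℝ] ℂ).wedge
        ((hasLefschetzProperty_lefschetzG (hR.exists_apply_ne_zero Φ)).andreHodgeInvolution isZGrading_countingG g (GForm.of s (δ : E [⋀^Fin s]→L[ℝ] ℂ)) t)).domDomCongr
          (finCongr hst)) := by
  rw [hR.weylPolarization_form Φ e hts, coe_weylPolarizationForm_eq_torusIntegral_wedge_andreHodgeInvolution Φ _ _ e hts hst]

end AndreForm

/-! ## §3 `*_H` is a `Q_w`-isometry and `Q_w`-self-adjoint -/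

section Isometry

omit [Fintype ι] [DecidableEq ι] [NormedAddCommGroup E] [NormedSpace ℂ E] [FiniteDimensional ℂ E] [Nontrivial E] in
/-- The sign bookkeeping `t(t−1)/2 + |k − g| + k(k−1)/2 ≡ 0 (mod 2)` for `t + k = 2g` (re-proved from row g48-#4, where it is private). [folklore] -/
private theorem even_weylSign₉₂ {g k t : ℕ} (htk : t + k = 2 * g) : Even (t * (t - 1) / 2 + ((k : ℤ) - (g : ℤ)).natAbs + k * (k - 1) / 2) := by
  obtain ⟨a, ha⟩ := Nat.even_mul_pred_self k
  obtain ⟨b, hb⟩ := Nat.even_mul_pred_self t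
  have ha' : k * (k - 1) / 2 = a := by omega
  have hb' : t * (t - 1) / 2 = b := by omega
  rw [ha', hb', ← Int.even_coe_nat]
  push_cast
  have hA : (k : ℤ) * k - k = a + a := by
    have h := congrArg (Nat.cast : ℕ → ℤ) ha
    rw [Nat.mul_sub_one, Nat.cast_sub (Nat.le_mul_self k)] at h
    push_cast at h
    exact h
  have hB : (t : ℤ) * t - t = b + b := by
    have h := congrArg (Nat.cast : ℕ → ℤ) hb
    rw [Nat.mul_sub_one, Nat.cast_sub (Nat.le_mul_self t)] at h
    push_cast at h
    exact h
  have hT : (t : ℤ) = 2 * g - k := by omega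
  have hsq : |(k : ℤ) - g| * |(k : ℤ) - g| = ((k : ℤ) - g) * ((k : ℤ) - g) := abs_mul_abs_self _
  have key : (b : ℤ) + |(k : ℤ) - g| + a = |(k : ℤ) - g| * (|(k : ℤ) - g| + 1) + g * (g - 1) := by
    have h2 : (2 : ℤ) * ((b : ℤ) + |(k : ℤ) - g| + a) = 2 * (|(k : ℤ) - g| * (|(k : ℤ) - g| + 1) + g * (g - 1)) := by
      linear_combination (-1 : ℤ) * hA + (-1 : ℤ) * hB + (-2 : ℤ) * hsq + ((t : ℤ) + 2 * g - k - 1) * hT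
    exact mul_left_cancel₀ two_ne_zero h2
  rw [key]
  exact (Int.even_mul_succ_self _).add (Int.even_mul_pred_self _)

omit [Fintype ι] [DecidableEq ι] [NormedAddCommGroup E] [NormedSpace ℂ E] [FiniteDimensional ℂ E] [Nontrivial E] in
/-- `(−1)^{t(t−1)/2} (−1)^{|k−g|} = (−1)^{k(k−1)/2}` for `t + k = 2g`. [folklore] -/
private theorem neg_one_pow_mul_neg_one_pow_natAbs_eq₉₂ {g k t : ℕ} (htk : t + k = 2 * g) :
    (-1 : ℂ) ^ (t * (t - 1) / 2) * (-1) ^ ((k : ℤ) - (g : ℤ)).natAbs = (-1) ^ (k * (k - 1) / 2) := by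
  have h := (even_weylSign₉₂ htk).neg_one_pow (α := ℂ)
  rw [pow_add, pow_add] at h
  have hS : ((-1 : ℂ) ^ (k * (k - 1) / 2)) ^ 2 = 1 := by
    rw [← pow_mul, mul_comm, pow_mul, neg_one_sq, one_pow]
  linear_combination (-1 : ℂ) ^ (k * (k - 1) / 2) * h - (-1 : ℂ) ^ (t * (t - 1) / 2) * (-1) ^ ((k : ℤ) - (g : ℤ)).natAbs * hS

omit [Fintype ι] [DecidableEq ι] [NormedAddCommGroup E] [NormedSpace ℂ E] [FiniteDimensional ℂ E] [Nontrivial E] in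
/-- `((−1)^N)² = 1`. [folklore] -/
private theorem neg_one_pow_mul_self₉₂ (N : ℕ) : (-1 : ℂ) ^ N * (-1) ^ N = 1 := by
  rw [← pow_add, ← two_mul, pow_mul, neg_one_sq, one_pow]

/-- **`*_H` IS A `Q_w`-ISOMETRY: `(−1)^{t(t−1)/2} B_t(*_H x, *_H y) = (−1)^{k(k−1)/2} B_k(x, y)`** for `x, y ∈ Hᵏ(X; ℂ)`, `t + k = 2g` (`*_H = ± w` on `Hᵏ` and `w` is a
`Q_w`-isometry, row g48-#4: `(−1)^{t(t−1)/2}(−1)^{|k−g|} = (−1)^{k(k−1)/2}`). [cite: Andre1996Motifs, §1.2 Prop. 1.2 (p. 11)] [cite: VoisinHodgeI2002, §7.1.2 Def. 7.7 (PDF p. 134)] -/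
theorem neg_one_pow_mul_weylPairing_andreHodgeInvolution_andreHodgeInvolution {g : ℕ} (e : Fin (2 * g) ≃ ι) {k t : ℕ} (htk : t + k = 2 * g) (hkt : k + t = 2 * g)
    (x y : E [⋀^Fin k]→L[ℝ] ℂ) :
    (-1 : ℂ) ^ (t * (t - 1) / 2) *
        weylPairing Φ hη e hkt ((hasLefschetzProperty_lefschetzG hη).andreHodgeInvolution isZGrading_countingG g (GForm.of k x) t)
          ((hasLefschetzProperty_lefschetzG hη).andreHodgeInvolution isZGrading_countingG g (GForm.of k y) t) =
      (-1 : ℂ) ^ (k * (k - 1) / 2) * weylPairing Φ hη e htk x y := by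
  have hg : finrank ℂ E = g := finrank_eq_of_finTwoMulEquiv Φ e
  rw [andreHodgeInvolution_of_apply hη hg, andreHodgeInvolution_of_apply hη hg]
  simp only [map_smul, LinearMap.smul_apply, smul_eq_mul]
  rw [← mul_assoc ((-1 : ℂ) ^ (g + k * (k - 1) / 2)), neg_one_pow_mul_self₉₂, one_mul, weylPairing_weylOperator_weylOperator Φ hη e htk hkt, ← mul_assoc,
    neg_one_pow_mul_neg_one_pow_natAbs_eq₉₂ htk]

/-- **`*_H` IS `Q_w`-SELF-ADJOINT: `(−1)^{t(t−1)/2} B_t(*_H x, z) = (−1)^{k(k−1)/2} B_k(x, *_H z)`** for `x ∈ Hᵏ`, `z ∈ Hᵗ`, `t + k = 2g` (an involutive isometry is self-adjoint: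
`z = *_H(*_H z)`). [cite: Andre1996Motifs, §1.1 Remarque and §1.2 Prop. 1.2 (p. 11)] -/
theorem neg_one_pow_mul_weylPairing_andreHodgeInvolution_left {g : ℕ} (e : Fin (2 * g) ≃ ι) {k t : ℕ} (htk : t + k = 2 * g) (hkt : k + t = 2 * g)
    (x : E [⋀^Fin k]→L[ℝ] ℂ) (z : E [⋀^Fin t]→L[ℝ] ℂ) :
    (-1 : ℂ) ^ (t * (t - 1) / 2) * weylPairing Φ hη e hkt ((hasLefschetzProperty_lefschetzG hη).andreHodgeInvolution isZGrading_countingG g (GForm.of k x) t) z =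
      (-1 : ℂ) ^ (k * (k - 1) / 2) *
        weylPairing Φ hη e htk x ((hasLefschetzProperty_lefschetzG hη).andreHodgeInvolution isZGrading_countingG g (GForm.of t z) k) := by
  have hg : finrank ℂ E = g := finrank_eq_of_finTwoMulEquiv Φ e
  -- `z = *_H(*_H z)` with `*_H z` homogeneous of degree `k`
  have hz : (hasLefschetzProperty_lefschetzG hη).andreHodgeInvolution isZGrading_countingG g
      (GForm.of k ((hasLefschetzProperty_lefschetzG hη).andreHodgeInvolution isZGrading_countingG g (GForm.of t z) k)) t = z := by
    rw [← andreHodgeInvolution_of_eq_of hη hg (by omega) z,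
      (hasLefschetzProperty_lefschetzG hη).andreHodgeInvolution_andreHodgeInvolution isZGrading_countingG g, GForm.of_apply_self]
  conv_lhs => rw [← hz]
  exact neg_one_pow_mul_weylPairing_andreHodgeInvolution_andreHodgeInvolution Φ hη e htk hkt x _

end Isometry

/-! ## §4 André's positivity Remarque in the tree's orientation: `(−1)^g ∫_X x ∧ *_H(x) > 0` on non-zero real `(p, p)`-classes -/

section Positivity

omit [Fintype ι] [DecidableEq ι] [NormedAddCommGroup E] [NormedSpace ℂ E] [FiniteDimensional ℂ E] [Nontrivial E] in
/-- `(−1)^{2p(2p−1)/2} = (−1)^p` (`2p(2p−1)/2 = p(2p−1) ≡ p`). [folklore] -/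
private theorem neg_one_pow_half_two_mul₉₂ (p : ℕ) : (-1 : ℂ) ^ (2 * p * (2 * p - 1) / 2) = (-1) ^ p := by
  have h : 2 * p * (2 * p - 1) / 2 = p * (2 * p - 1) := by rw [mul_assoc, Nat.mul_div_cancel_left _ two_pos]
  rw [h]
  rcases Nat.even_or_odd p with ⟨a, rfl⟩ | ⟨a, rfl⟩
  · have h1 : Even ((a + a) * (2 * (a + a) - 1)) := ⟨a * (2 * (a + a) - 1), by ring⟩
    rw [h1.neg_one_pow, (show Even (a + a) from ⟨a, rfl⟩).neg_one_pow]
  · have h1 : Odd ((2 * a + 1) * (2 * (2 * a + 1) - 1)) := by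
      rw [show 2 * (2 * a + 1) - 1 = 2 * (2 * a) + 1 by omega]
      exact (odd_two_mul_add_one a).mul (odd_two_mul_add_one (2 * a))
    rw [h1.neg_one_pow, (odd_two_mul_add_one a).neg_one_pow]

/-- **ANDRÉ'S POSITIVITY REMARQUE ("cet opérateur star et `*_H` ont les mêmes propriétés de positivité sur les cycles réels de type `(p,p)`"), in the tree's
orientation: `(−1)^g ∫_X x ∧ *_H(x) = c > 0`** for every non-zero REAL class `x` of type `(p, p)` in `H^{2p}(X; ℂ)`, every `2p ≤ 2g`, `η` positive of type `(1,1)`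
and non-degenerate (a Kähler datum): from the Hodge–Riemann relations for the Weyl pairing (row g48-#2, below and above the middle degree: `(−1)^p ∫_X w(x) ∧ x > 0`) and
`*_H = (−1)^{g + p(2p−1)} w` on `H^{2p}`. The sign `(−1)^g` is the tree's orientation convention (`∫_X η^{∧g} = (−1)^g g! d₁⋯d_g`, `c₁ = −Im H`).
[cite: Andre1996Motifs, §1.1 Remarque (p. 11)] [cite: VoisinHodgeI2002, §6.3.2 Thm. 6.32, §7.1.2 (ii)] [cite: Lange2023AbelianVarietiesComplex, §1.7.2 Lemma 1.7.4, Lemma 1.7.5] -/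
theorem exists_pos_neg_one_pow_mul_torusIntegral_wedge_andreHodgeInvolution (h11 : ∀ u v : E, η ![I • u, I • v] = η ![u, v])
    (hpos : ∀ u : E, u ≠ 0 → 0 < η ![I • u, u]) (hη : ∀ v : E, v ≠ 0 → ∃ w : E, η ![v, w] ≠ 0) {g : ℕ} (e : Fin (2 * g) ≃ ι) {p t : ℕ}
    (htk : t + 2 * p = 2 * g) (hkt : 2 * p + t = 2 * g) {x : E [⋀^Fin (2 * p)]→L[ℝ] ℂ} (hx : x ∈ typeSubmodule E (2 * p) p p) (hreal : conjForm x = x)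
    (hx0 : x ≠ 0) :
    ∃ c : ℝ, 0 < c ∧
      (-1 : ℂ) ^ g * torusIntegral Φ e ((x.wedge ((hasLefschetzProperty_lefschetzG hη).andreHodgeInvolution isZGrading_countingG g (GForm.of (2 * p) x) t)).domDomCongr
        (finCongr hkt)) = c := by
  have hg : finrank ℂ E = g := finrank_eq_of_finTwoMulEquiv Φ e
  -- `(−1)^g ∫ x ∧ *_H x = (−1)^{p(2p−1)} B_{2p}(x, x) = (−1)^p ∫ w(x) ∧ x`
  have h1 := neg_one_pow_mul_weylPairing_eq_torusIntegral_wedge_andreHodgeInvolution Φ hη e htk hkt x x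
  rw [neg_one_pow_half_two_mul₉₂, weylPairing_apply] at h1
  rw [← h1]
  by_cases hp : 2 * p ≤ g
  · -- below the middle: Hodge–Riemann for the Weyl pairing, row g48-#2
    exact hodgeRiemann_torusIntegral_weylOperator_of_wedge_self Φ h11 hpos hη e (j := g - 2 * p) (by omega) (by omega) htk hx hreal hx0
  · -- above the middle: the `_of_le` relation of row g48-#2 with `conj x = x`, `i^{p−p} = 1`
    obtain ⟨c, hc, hcx⟩ := hodgeRiemann_torusIntegral_weylOperator_of_wedge_conjForm_of_le Φ h11 hpos hη e (k := t) (j := 2 * p - g) (t := 2 * p) (by omega)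
      (by omega) htk (p := p) (q := p) (by omega) hx hx0
    refine ⟨c, hc, ?_⟩
    rw [← hcx, neg_one_pow_half_two_mul₉₂, sub_self, zpow_zero, mul_one, hreal]

end Positivity

/-! ## §5 André's Prop. 1.2 for `(x, y) ↦ ∫ x ∪ *_H y` and Beauville's `ρ(γ)` on the torus (appended, row g49-#5) -/

section AndreTranspose

open scoped MatrixGroups

/-- **ANDRÉ'S PROPOSITION 1.2, LAST CLAUSE, FOR HIS OWN FORM ON A COMPLEX TORUS: `∫_X (ρ(γ)(of k x))_l ∧ *_H(of l y) = ∫_X x ∧ *_H(of k ((ρ(γᵀ)(of l y))_k))` for every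
`γ ∈ SL₂(ℂ)`**, `x ∈ Hᵏ(X; ℂ)`, `y ∈ Hˡ(X; ℂ)` (`k, l ≤ 2g`): for the bilinear form `(x, y) ↦ ∫ x ∪ *_H y` the transpose of Beauville's `ρ(γ)` is `ρ(γᵀ)` — "la
transposition relative à la forme bilinéaire `(x, y) ↦ ∫ x ∪ *y` correspond à la transposition des matrices, pour `* = *_H`" — from row g49-#2 (`Q_w`) and §2 (`Q_w = (−1)^g ∫ x ∧ *_H y`);
the orientation sign `(−1)^g` cancels. [cite: Andre1996Motifs, §1.2 Prop. 1.2 (pp. 11–12)] [cite: Beauville2010SL2, §4 Theorem] -/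
theorem torusIntegral_sl2Rep_of_apply_wedge_andreHodgeInvolution {g : ℕ} (e : Fin (2 * g) ≃ ι) (γ : SL(2, ℂ)) {k l tk tl : ℕ} (htk : tk + k = 2 * g)
    (hkt : k + tk = 2 * g) (htl : tl + l = 2 * g) (hlt : l + tl = 2 * g) (x : E [⋀^Fin k]→L[ℝ] ℂ) (y : E [⋀^Fin l]→L[ℝ] ℂ) :
    torusIntegral Φ e ((((hasLefschetzProperty_lefschetzG hη).sl2Rep isZGrading_countingG γ (GForm.of k x) l).wedge
        ((hasLefschetzProperty_lefschetzG hη).andreHodgeInvolution isZGrading_countingG g (GForm.of l y) tl)).domDomCongr (finCongr hlt)) =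
      torusIntegral Φ e ((x.wedge ((hasLefschetzProperty_lefschetzG hη).andreHodgeInvolution isZGrading_countingG g
        (GForm.of k ((hasLefschetzProperty_lefschetzG hη).sl2Rep isZGrading_countingG γ.transpose (GForm.of l y) k)) tk)).domDomCongr (finCongr hkt)) := by
  have h2 := weylPairing_sl2Rep_of_apply_transpose Φ hη e γ htk htl x y
  rw [neg_one_pow_mul_weylPairing_eq_torusIntegral_wedge_andreHodgeInvolution Φ hη e htl hlt,
    neg_one_pow_mul_weylPairing_eq_torusIntegral_wedge_andreHodgeInvolution Φ hη e htk hkt] at h2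
  exact mul_left_cancel₀ (pow_ne_zero _ (neg_ne_zero.2 one_ne_zero)) h2

/-- The same with `*_H` in the first slot: **`∫_X *_H((ρ(γ)(of k x))_l) ∧ y = ∫_X *_H(of k x) ∧ (ρ(γᵀ)(of l y))_k`** (`*_H` is self-adjoint for `∫`).
[cite: Andre1996Motifs, §1.1 Remarque and §1.2 Prop. 1.2 (pp. 11–12)] -/
theorem torusIntegral_andreHodgeInvolution_sl2Rep_of_apply_wedge {g : ℕ} (e : Fin (2 * g) ≃ ι) (γ : SL(2, ℂ)) {k l tk tl : ℕ} (htk : tk + k = 2 * g)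
    (htl : tl + l = 2 * g) (x : E [⋀^Fin k]→L[ℝ] ℂ) (y : E [⋀^Fin l]→L[ℝ] ℂ) :
    torusIntegral Φ e ((((hasLefschetzProperty_lefschetzG hη).andreHodgeInvolution isZGrading_countingG g
        (GForm.of l ((hasLefschetzProperty_lefschetzG hη).sl2Rep isZGrading_countingG γ (GForm.of k x) l)) tl).wedge y).domDomCongr (finCongr htl)) =
      torusIntegral Φ e ((((hasLefschetzProperty_lefschetzG hη).andreHodgeInvolution isZGrading_countingG g (GForm.of k x) tk).wedge
        ((hasLefschetzProperty_lefschetzG hη).sl2Rep isZGrading_countingG γ.transpose (GForm.of l y) k)).domDomCongr (finCongr htk)) := by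
  have h2 := weylPairing_sl2Rep_of_apply_transpose Φ hη e γ htk htl x y
  rw [neg_one_pow_mul_weylPairing_eq_torusIntegral_andreHodgeInvolution_wedge Φ hη e htl,
    neg_one_pow_mul_weylPairing_eq_torusIntegral_andreHodgeInvolution_wedge Φ hη e htk] at h2
  exact mul_left_cancel₀ (pow_ne_zero _ (neg_ne_zero.2 one_ne_zero)) h2

/-- **The unipotents for André's form: `∫_X (exp(a L_η)(of k x))_l ∧ *_H(of l y) = ∫_X x ∧ *_H(of k ((exp(a Λ_η)(of l y))_k))`** — Beauville's `(1 a ; 0 1)·z = e^{aθ} z` against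
its transpose. [cite: Beauville2010SL2, §4 Theorem] [cite: Andre1996Motifs, §1.2 Prop. 1.2 (p. 12, proof: "ces générateurs s'échangent par la transposition")] -/
theorem torusIntegral_exp_smul_lefschetzG_of_apply_wedge_andreHodgeInvolution {g : ℕ} (e : Fin (2 * g) ≃ ι) (a : ℂ) {k l tk tl : ℕ} (htk : tk + k = 2 * g)
    (hkt : k + tk = 2 * g) (htl : tl + l = 2 * g) (hlt : l + tl = 2 * g) (x : E [⋀^Fin k]→L[ℝ] ℂ) (y : E [⋀^Fin l]→L[ℝ] ℂ) :
    letI := Algebra.compHom (Module.End ℂ (GForm E ℂ)) (algebraMap ℚ ℂ)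
    torusIntegral Φ e (((IsNilpotent.exp (a • lefschetzG η) (GForm.of k x) l).wedge
        ((hasLefschetzProperty_lefschetzG hη).andreHodgeInvolution isZGrading_countingG g (GForm.of l y) tl)).domDomCongr (finCongr hlt)) =
      torusIntegral Φ e ((x.wedge ((hasLefschetzProperty_lefschetzG hη).andreHodgeInvolution isZGrading_countingG g
        (GForm.of k (IsNilpotent.exp (a • lefschetzDualG η) (GForm.of l y) k)) tk)).domDomCongr (finCongr hkt)) := by
  have h2 := weylPairing_exp_smul_lefschetzG_of_apply Φ hη e a htk htl x y
  rw [neg_one_pow_mul_weylPairing_eq_torusIntegral_wedge_andreHodgeInvolution Φ hη e htl hlt,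
    neg_one_pow_mul_weylPairing_eq_torusIntegral_wedge_andreHodgeInvolution Φ hη e htk hkt] at h2
  exact mul_left_cancel₀ (pow_ne_zero _ (neg_ne_zero.2 one_ne_zero)) h2

/-- **"contiennent les projecteurs de Künneth": every `T ∈ ℂ[L_η, Λ_η]` commuting with `H` is SYMMETRIC for André's form** —
`∫_X (T(of k x))_k ∧ *_H(of k y) = ∫_X x ∧ *_H(of k ((T(of k y))_k))` for `x, y ∈ Hᵏ(X; ℂ)` (Kleiman's `pʲ`, the Lefschetz–Künneth projectors `π_{s,r}`, `w²`, the Casimir).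
[cite: Andre1996Motifs, §1.2 Prop. 1.2 (pp. 11–12)] [cite: Kleiman1968AlgebraicCycles, §1.4 (1.4.4–1.4.5)] -/
theorem torusIntegral_apply_of_wedge_andreHodgeInvolution_of_mem_adjoin_pair_of_commute {g : ℕ} (e : Fin (2 * g) ≃ ι) {T : Module.End ℂ (GForm E ℂ)}
    (hT : T ∈ Algebra.adjoin ℂ ({lefschetzG η, lefschetzDualG η} : Set (Module.End ℂ (GForm E ℂ)))) (hTh : Commute (countingG E) T) {k tk : ℕ}
    (htk : tk + k = 2 * g) (hkt : k + tk = 2 * g) (x y : E [⋀^Fin k]→L[ℝ] ℂ) :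
    torusIntegral Φ e (((T (GForm.of k x) k).wedge ((hasLefschetzProperty_lefschetzG hη).andreHodgeInvolution isZGrading_countingG g (GForm.of k y) tk)).domDomCongr
        (finCongr hkt)) =
      torusIntegral Φ e ((x.wedge ((hasLefschetzProperty_lefschetzG hη).andreHodgeInvolution isZGrading_countingG g (GForm.of k (T (GForm.of k y) k)) tk)).domDomCongr
        (finCongr hkt)) := by
  have h1 := weylPairing_apply_of_eq_of_mem_adjoin_pair_of_commute Φ hη e hT hTh htk x y
  have h2 : (-1 : ℂ) ^ (k * (k - 1) / 2) * weylPairing Φ hη e htk (T (GForm.of k x) k) y =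
      (-1 : ℂ) ^ (k * (k - 1) / 2) * weylPairing Φ hη e htk x (T (GForm.of k y) k) := by rw [h1]
  rw [neg_one_pow_mul_weylPairing_eq_torusIntegral_wedge_andreHodgeInvolution Φ hη e htk hkt,
    neg_one_pow_mul_weylPairing_eq_torusIntegral_wedge_andreHodgeInvolution Φ hη e htk hkt] at h2
  exact mul_left_cancel₀ (pow_ne_zero _ (neg_ne_zero.2 one_ne_zero)) h2

end AndreTranspose

end ComplexTorus

end Literature.Geometry.Kaehler
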